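import Summits.QuantumFields.YangMills.Theorems.FluctuationComparisonRegPrIntLOrganTangentFibreWeightNormalisation
import HarnessLib

/-!
# Route `UnitScaleTilt` — crux `FluctuationComparisonRegPrIntL` (stmt-QuantumFields-20520, rung R3), PATH-B organ: «THE ENDPOINT TAIL IS A SUM OF PER-PLAQUETTE TAILS» —
# the `ŵ_s`-mass of the complement of a small-field window is at most the sum over plaquettes of the single-plaquette large-field masses (SPEC (xv-b) «A5 TAIL THRESHOLD»)

Cell `ym3-torus` (YM ladder rung R3 = continuum `SU(2)` Yang–Mills on the three-torus — a RUNG: NOT d = 4, NOT infinite volume, NOT a mass gap, NOT Clay).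
Width seat `ym-ust-20520-w4` (gen 26), (xv-b) lane (after ✓p832486 ∕ ✓p832596 ∕ ✓p832714 ∕ ✓p833107 ∕ ✓p833183); `--kind proof --supports stmt-QuantumFields-20520 --as
helper`, count-neutral, DEFINITION-FREE, no registry ∕ binder ∕ `Lines/` edit, default heartbeats, `autoImplicit false`.

WHAT.  ✓`…OrganTangentGoodSetTailVariance.setIntegral_wgt_le_of_endpointTails_pathVariance` reduces A5's Good-set tail clause (every `t ∈ [0,1]`) to two ENDPOINT tail
letters `∫_A ŵ₀ ≤ ES₀`, `∫_A ŵ₁ ≤ ES₁` and a path variance.  For the Good set of record `Good := {z | PlaqSmall θ′ (Φ(V,z))}` ((xv-b); `θ′ = θ_Ts∕4 − 3·Db·rc` in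
✓`…OrganTangentGoodSetMargin`) the complement is a FINITE UNION of single-plaquette large-field events, so:
* §1 [folklore] `setIntegral_le_sum_setIntegral_of_subset_iUnion` — any measure, `f ≥ 0` integrable, `ι` finite, `A ⊆ ⋃ p, L p` ⟹ `∫_A f ≤ ∑ p, ∫_{L p} f`
  (`Measure.restrict_iUnion_le` + `integral_mono_measure` + `integral_finsetSum_measure`);
* §2 `setIntegral_wgt_le_sum_of_subset_iUnion` — the same in the frame's letters for ANY fibre event `A ⊆ ⋃ p, L p` under `ŵ_s` (so every Good set of record is served),
  and ★`setIntegral_wgt_compl_plaqSmall_le_sum` — any real `s`, any threshold `θ′`, a window point `V`: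
  `∫ z in {z | ¬ PlaqSmall θ′ (Φ (V, z))}, ŵ_s(V,z) dτ ≤ ∑ p : Plaq, ∫ z in {z | θ′ ≤ dist1 (plaqHol (Φ (V, z)) p)}, ŵ_s(V,z) dτ`.
So `ES₀`, `ES₁` are fed by PER-PLAQUETTE conditional tails «plaquette `p` of the fine field over `V` is off the window, under `ŵ₀` ∕ `ŵ₁`» times `#Plaq_Ts` — the currency
of [Balaban1985UV3] (7) p. 257 ∕ (71) (`χ = Π_p χ(p)`; each large plaquette costs `e^{−c·p(g)²}`), the same shape the S1a lane uses at measure level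
(✓`…S1aOneStepLetterOfPlaquetteTails`).  Nothing of that estimate is asserted here.

HONEST FRAMING: [folklore] subadditivity over the frame's HYPOTHESIS letters; nothing of Bałaban's analysis is asserted or proved; (xv-b) is NOT discharged (the per-plaquette
tails remain print's); `SpreadFibreLawHJ(sq)`(ᴱ) ∕ `OrganDischargeInputsHJ(sq)` (every edition) UNDISCHARGED; the five registered stubs of `Lines/runpair_organ.lean` (registry
3732b7df, untouched), crux 20520 and `YM3TorusSU2` are NOT proved; rung R3 = SU(2) YM₃ on T³ at fixed lattice data — NOT d = 4, NOT infinite volume, NOT a mass gap, NOT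
Clay; the Yang–Mills mass gap is NOT proved.
-/

set_option autoImplicit false

noncomputable section

namespace Summit.QuantumFields.YangMills.Theorems.OrganTangentGoodSetTailPlaquetteUnion

open MeasureTheory Filter Topology
open scoped ENNReal NNReal
open Literature.MathematicalPhysics.QuantumFieldTheory.Balaban1983to89 T3ContinuumYM3Torus T3NestedUnitLaws
  T3UnitLawDensityEML T4Continuum T3UnitScaleTilt T3LevelShift T3TiltDescent
open Summit.QuantumFields.YangMills.Theorems.FluctuationComparisonRegPrIntLRunpairOrganFibreLaw (mwCut wNum wgt)
open Summit.QuantumFields.YangMills.Theorems.OrganTangentFibreWeightNormalisation (wgt_normalised wgt_nonneg)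

/-! ## §1 A finite union bound for set integrals of a non-negative integrable function -/

/-- **Union bound** — on any measure space, for `f ≥ 0` integrable, a finite index type and `A ⊆ ⋃ p, L p`: `∫_A f ≤ ∑ p, ∫_{L p} f`
(`μ|_{⋃ L p} ≤ ∑ μ|_{L p}` as measures). [folklore] -/
theorem setIntegral_le_sum_setIntegral_of_subset_iUnion {Ω ι : Type*} [MeasurableSpace Ω] [Fintype ι] (μ : Measure Ω) {f : Ω → ℝ}
    (hf0 : ∀ ω, 0 ≤ f ω) (hfi : Integrable f μ) {A : Set Ω} {L : ι → Set Ω} (hAL : A ⊆ ⋃ p, L p) :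
    ∫ ω in A, f ω ∂μ ≤ ∑ p, ∫ ω in L p, f ω ∂μ := by
  have h1 : ∫ ω in A, f ω ∂μ ≤ ∫ ω in ⋃ p, L p, f ω ∂μ :=
    setIntegral_mono_set hfi.integrableOn (Eventually.of_forall hf0) hAL.eventuallyLE
  have hle : μ.restrict (⋃ p, L p) ≤ ∑ p, μ.restrict (L p) := by
    rw [← Measure.sum_fintype]; exact Measure.restrict_iUnion_le
  have hint : ∀ p ∈ (Finset.univ : Finset ι), Integrable f (μ.restrict (L p)) := fun p _ => hfi.restrict
  have h2 : ∫ ω in ⋃ p, L p, f ω ∂μ ≤ ∫ ω, f ω ∂(∑ p, μ.restrict (L p)) :=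
    integral_mono_measure hle (Eventually.of_forall hf0) (integrable_finsetSum_measure.2 hint)
  rw [integral_finsetSum_measure hint] at h2
  exact h1.trans h2

/-! ## §2 Any fibre event covered by finitely many events, under `ŵ_s`; then the complement of a small-field window -/

/-- **General form in the frame's letters** — binders of ✓`wgt_normalised`, any real `s`, a window point `V`, a finite index type and ANY fibre event `A ⊆ ⋃ p, L p`:
`∫_A ŵ_s(V,·) dτ ≤ ∑ p, ∫_{L p} ŵ_s(V,·) dτ` (serves every Good set of record: the quarter window, the (P4) margin `θ_Ts∕4 − 3·Db·rc` of ✓`…OrganTangentGoodSetMargin`, annulus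
variants). [folklore] -/
theorem setIntegral_wgt_le_sum_of_subset_iUnion (F : T3Family) (γ b₀ p₀ : ℝ) (j Ts : ℕ) (hjTs : j + 1 ≤ Ts)
    (ρ ρ' : (i : ℕ) → GaugeField (F.P i) 0 ↥(Matrix.specialUnitaryGroup (Fin 2) ℂ) → ℝ)
    (hρm : Measurable (ρ Ts)) (hρ'm : Measurable (ρ' Ts))
    (hρc : ContinuousOn (ρ Ts) {U | PlaqSmall (θBal F.L γ b₀ p₀ Ts) U}) (hρ'c : ContinuousOn (ρ' Ts) {U | PlaqSmall (θBal F.L γ b₀ p₀ Ts) U})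
    (hρpos : ∀ U, PlaqSmall (θBal F.L γ b₀ p₀ Ts) U → 0 < ρ Ts U ∧ 0 < ρ' Ts U)
    (hθ : 0 < θBal F.L γ b₀ p₀ Ts)
    (hχc : Continuous (mwCut F γ b₀ p₀ j Ts)) (hχ0 : ∀ U, 0 ≤ mwCut F γ b₀ p₀ j Ts U)
    (hχsupp : ∀ U, mwCut F γ b₀ p₀ j Ts U ≠ 0 → ∀ (n : ℕ) (hjn : j + 1 ≤ n) (hnK : n ≤ Ts), PlaqSmall (24 / 25 * θBal F.L γ b₀ p₀ n) (descendTo F ℰp n Ts hnK U))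
    (hχpos : ∀ U, (∀ (n : ℕ) (hjn : j + 1 ≤ n) (hnK : n ≤ Ts), PlaqSmall (24 / 25 * θBal F.L γ b₀ p₀ n) (descendTo F ℰp n Ts hnK U)) → 0 < mwCut F γ b₀ p₀ j Ts U)
    {Z : Type} [MeasurableSpace Z] (τ : Measure Z) [IsProbabilityMeasure τ]
    (Φ : GaugeField (F.P j) 0 ↥(Matrix.specialUnitaryGroup (Fin 2) ℂ) × Z → GaugeField (F.P Ts) 0 ↥(Matrix.specialUnitaryGroup (Fin 2) ℂ))
    (J : GaugeField (F.P j) 0 ↥(Matrix.specialUnitaryGroup (Fin 2) ℂ) × Z → ℝ≥0)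
    (hΦm : Measurable Φ) (hJm : Measurable J) (CJ : ℝ) (hJle : ∀ V z, (J (V, z) : ℝ) ≤ CJ)
    (hpos : ∀ V, PlaqSmall (θBal F.L γ b₀ p₀ j) V →
      0 < ∫⁻ z in {z | (∀ (n : ℕ) (hjn : j + 1 ≤ n) (hnK : n ≤ Ts), PlaqSmall (24 / 25 * θBal F.L γ b₀ p₀ n) (descendTo F ℰp n Ts hnK (Φ (V, z))))},
        (J (V, z) : ℝ≥0∞) ∂τ)
    (s : ℝ) (V : GaugeField (F.P j) 0 ↥(Matrix.specialUnitaryGroup (Fin 2) ℂ)) (hV : PlaqSmall (θBal F.L γ b₀ p₀ j) V)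
    {ι : Type*} [Fintype ι] {A : Set Z} {L : ι → Set Z} (hAL : A ⊆ ⋃ p, L p) :
    ∫ z in A, wgt F γ b₀ p₀ j Ts ρ ρ' τ Φ J s V z ∂τ ≤ ∑ p, ∫ z in L p, wgt F γ b₀ p₀ j Ts ρ ρ' τ Φ J s V z ∂τ := by
  have hN := wgt_normalised F γ b₀ p₀ j Ts hjTs ρ ρ' hρm hρ'm hρc hρ'c hρpos hθ hχc hχ0 hχsupp hχpos τ Φ J hΦm hJm CJ hJle hpos s V hV
  have hnn := wgt_nonneg F γ b₀ p₀ j Ts hjTs ρ ρ' hρpos hθ hχ0 hχsupp τ Φ J s V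
  exact setIntegral_le_sum_setIntegral_of_subset_iUnion τ hnn hN.2.2.1 hAL

/-- ★ **THE ENDPOINT TAIL IS A SUM OF PER-PLAQUETTE TAILS** — in the frame's letters (binders of ✓`wgt_normalised`), for every real `s`, threshold `θ′` and window point `V`:
`∫ z in {z | ¬ PlaqSmall θ′ (Φ (V, z))}, ŵ_s(V,z) dτ ≤ ∑ p, ∫ z in {z | θ′ ≤ dist1 (plaqHol (Φ (V, z)) p)}, ŵ_s(V,z) dτ` (the complement of the window is the finite union of the
single-plaquette large-field events; `ŵ_s ≥ 0` integrable by ✓`wgt_normalised`).  The (xv-b) endpoint tails `ES₀, ES₁` in per-plaquette currency ([Balaban1985UV3] (7) p. 257, shape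
only). [folklore] -/
theorem setIntegral_wgt_compl_plaqSmall_le_sum (F : T3Family) (γ b₀ p₀ : ℝ) (j Ts : ℕ) (hjTs : j + 1 ≤ Ts)
    (ρ ρ' : (i : ℕ) → GaugeField (F.P i) 0 ↥(Matrix.specialUnitaryGroup (Fin 2) ℂ) → ℝ)
    (hρm : Measurable (ρ Ts)) (hρ'm : Measurable (ρ' Ts))
    (hρc : ContinuousOn (ρ Ts) {U | PlaqSmall (θBal F.L γ b₀ p₀ Ts) U}) (hρ'c : ContinuousOn (ρ' Ts) {U | PlaqSmall (θBal F.L γ b₀ p₀ Ts) U})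
    (hρpos : ∀ U, PlaqSmall (θBal F.L γ b₀ p₀ Ts) U → 0 < ρ Ts U ∧ 0 < ρ' Ts U)
    (hθ : 0 < θBal F.L γ b₀ p₀ Ts)
    (hχc : Continuous (mwCut F γ b₀ p₀ j Ts)) (hχ0 : ∀ U, 0 ≤ mwCut F γ b₀ p₀ j Ts U)
    (hχsupp : ∀ U, mwCut F γ b₀ p₀ j Ts U ≠ 0 → ∀ (n : ℕ) (hjn : j + 1 ≤ n) (hnK : n ≤ Ts), PlaqSmall (24 / 25 * θBal F.L γ b₀ p₀ n) (descendTo F ℰp n Ts hnK U))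
    (hχpos : ∀ U, (∀ (n : ℕ) (hjn : j + 1 ≤ n) (hnK : n ≤ Ts), PlaqSmall (24 / 25 * θBal F.L γ b₀ p₀ n) (descendTo F ℰp n Ts hnK U)) → 0 < mwCut F γ b₀ p₀ j Ts U)
    {Z : Type} [MeasurableSpace Z] (τ : Measure Z) [IsProbabilityMeasure τ]
    (Φ : GaugeField (F.P j) 0 ↥(Matrix.specialUnitaryGroup (Fin 2) ℂ) × Z → GaugeField (F.P Ts) 0 ↥(Matrix.specialUnitaryGroup (Fin 2) ℂ))
    (J : GaugeField (F.P j) 0 ↥(Matrix.specialUnitaryGroup (Fin 2) ℂ) × Z → ℝ≥0)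
    (hΦm : Measurable Φ) (hJm : Measurable J) (CJ : ℝ) (hJle : ∀ V z, (J (V, z) : ℝ) ≤ CJ)
    (hpos : ∀ V, PlaqSmall (θBal F.L γ b₀ p₀ j) V →
      0 < ∫⁻ z in {z | (∀ (n : ℕ) (hjn : j + 1 ≤ n) (hnK : n ≤ Ts), PlaqSmall (24 / 25 * θBal F.L γ b₀ p₀ n) (descendTo F ℰp n Ts hnK (Φ (V, z))))},
        (J (V, z) : ℝ≥0∞) ∂τ)
    (s θ' : ℝ) (V : GaugeField (F.P j) 0 ↥(Matrix.specialUnitaryGroup (Fin 2) ℂ)) (hV : PlaqSmall (θBal F.L γ b₀ p₀ j) V) :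
    ∫ z in {z | ¬ PlaqSmall θ' (Φ (V, z))}, wgt F γ b₀ p₀ j Ts ρ ρ' τ Φ J s V z ∂τ
      ≤ ∑ p : Plaq (F.P Ts) 0, ∫ z in {z | θ' ≤ dist1 (GaugeField.plaqHol (Φ (V, z)) p)}, wgt F γ b₀ p₀ j Ts ρ ρ' τ Φ J s V z ∂τ := by
  classical
  have hsub : {z | ¬ PlaqSmall θ' (Φ (V, z))} ⊆ ⋃ p : Plaq (F.P Ts) 0, {z | θ' ≤ dist1 (GaugeField.plaqHol (Φ (V, z)) p)} := by
    intro z hz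
    simp only [Set.mem_setOf_eq, PlaqSmall, not_forall, not_lt] at hz
    obtain ⟨p, hp⟩ := hz
    exact Set.mem_iUnion.2 ⟨p, hp⟩
  exact setIntegral_wgt_le_sum_of_subset_iUnion F γ b₀ p₀ j Ts hjTs ρ ρ' hρm hρ'm hρc hρ'c hρpos hθ hχc hχ0 hχsupp hχpos τ Φ J hΦm hJm CJ hJle hpos
    s V hV hsub

end Summit.QuantumFields.YangMills.Theorems.OrganTangentGoodSetTailPlaquetteUnion

end
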